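import Summits.RiemannHypothesis.RiemannHypothesis.Theorems.ThetaTier1UC
import Summits.RiemannHypothesis.RiemannHypothesis.Theorems.ThetaTier1ChebRowsHead
import HarnessLib

/-!
# Route `WeilSemilocal`, item `SemilocalRowsToOneFiftySeven` (stmt-RiemannHypothesis-19396): the ten gap-`≥ 4` rows `80 ≤ q < 157` by TIER-1 theta certificates (RH-FREE)

Cell `rh-explicit`, WEIL column (LADDER-RH W-P(P2)); seat weil-1 gen20. From the head data module `ThetaTier1ChebRowsHead` (kernel verdict
`checkAllCheb = true` on the deposit rows for q = 83, 89, 97, 103, 109, 113, 127, 131, 139, 151) and the FIN glue `ThetaTier1UC.walls_of_rows`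
((AR) cc-s2-1 ∘ (AN) weil-1, RS-free): the wall sentence `∀ q' prime, q < q' → a*(S_q) < (log q')/2` at each of the ten primes, and the upper
clauses at the two rows the item was missing, **`q = 103`** (`a*(S_103) < (log 107)/2`) and **`q = 109`** (`a*(S_109) < (log 113)/2`). The item
itself still needs the three lower twins 101, 137, 149 (tier 2 / K-cells). Upper clauses of TRUNCATED Weil forms; nothing here bears on the truth of RH.
-/

set_option linter.dupNamespace false  -- the mandated namespace repeats `RiemannHypothesis`

namespace Summit.RiemannHypothesis.RiemannHypothesis.Theorems.WeilSemilocalRoute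

open Summit.RiemannHypothesis.RiemannHypothesis.Theorems.ThetaTier1

/-- The prime column of the head data module. [this cell] -/
theorem thetaHead_map_q : thetaTier1ChebRowsHead.map Row.q = [83, 89, 97, 103, 109, 113, 127, 131, 139, 151] := by
  decide +kernel

/-- **The wall sentence at the ten gap-`≥ 4` head primes** `q ∈ {83, 89, 97, 103, 109, 113, 127, 131, 139, 151}`: for every prime `q' > q`,
`a*(S_q) < (log q')/2` — tier-1 theta kernel certificates, RS-free. [this cell; THETA-ASSIGN §2; RH-FREE] -/
theorem thetaHead_walls : ∀ q ∈ ([83, 89, 97, 103, 109, 113, 127, 131, 139, 151] : List ℕ), ∀ q' : ℕ, q'.Prime → q < q' →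
    MotivicDoor.SemilocalThreshold.weilSemilocalThreshold (Nat.primesBelow q) < Real.log q' / 2 := by
  rw [← thetaHead_map_q]
  exact walls_of_rows thetaTier1ChebRowsHead_realCert thetaTier1ChebRowsHead_facts'

/-- **Row `q = 103`** (S = the 26 primes `≤ 101`, next prime 107): `a*(S_103) < (log 107)/2`. [this cell; THETA tier 1; RH-FREE] -/
theorem weilSemilocalThreshold_uptoHundredOne_lt_log_hundredSeven_half :
    MotivicDoor.SemilocalThreshold.weilSemilocalThreshold (Nat.primesBelow 103) < Real.log 107 / 2 := by
  have h := thetaHead_walls 103 (by decide) 107 (by norm_num) (by norm_num)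
  exact_mod_cast h

/-- **Row `q = 109`** (S = the 27 primes `≤ 107`, next prime 113): `a*(S_109) < (log 113)/2`. [this cell; THETA tier 1; RH-FREE] -/
theorem weilSemilocalThreshold_uptoHundredSeven_lt_log_hundredThirteen_half :
    MotivicDoor.SemilocalThreshold.weilSemilocalThreshold (Nat.primesBelow 109) < Real.log 113 / 2 := by
  have h := thetaHead_walls 109 (by decide) 113 (by norm_num) (by norm_num)
  exact_mod_cast h

/-- The wall sentence at `q = 103` in the item's quantified form. [this cell; RH-FREE] -/
theorem wall_hundredThree : ∀ q' : ℕ, q'.Prime → 103 < q' →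
    MotivicDoor.SemilocalThreshold.weilSemilocalThreshold (Nat.primesBelow 103) < Real.log q' / 2 :=
  thetaHead_walls 103 (by decide)

/-- The wall sentence at `q = 109` in the item's quantified form. [this cell; RH-FREE] -/
theorem wall_hundredNine : ∀ q' : ℕ, q'.Prime → 109 < q' →
    MotivicDoor.SemilocalThreshold.weilSemilocalThreshold (Nat.primesBelow 109) < Real.log q' / 2 :=
  thetaHead_walls 109 (by decide)

end Summit.RiemannHypothesis.RiemannHypothesis.Theorems.WeilSemilocalRoute
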